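import Literature.Computability.QuantumComplexity.OracleSeparationBQPPH
import Literature.Computability.Complexity.CoinCounting
import HarnessLib

/-!
# The oracle separation `BQP^A ⊄ BPP^A` from the Forrelation oracle (Raz–Tal, App. A, run against `BPP`)

Topic `Literature/Computability/QuantumComplexity`. This file reduces the named fact
`exists_oracle_BQPRel_not_subset_BPPRel` (**quantum-advantage.S13**: there is an oracle `A` with
`BQP^A ⊄ BPP^A`; Bernstein–Vazirani 1997, §8.4, Thm. 8.10 with Cor. 8.14, via recursive Fourier
sampling) to the named facts of the sibling file `OracleSeparationBQPPH.lean` (Raz–Tal 2022, App. A: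
`RazTal2022_bqpMachine`, `RazTal2022_claim81`, `FSS84_phWindowCircuits`,
`countable_polyTimeOracleAlg`, `RazTal2022_thm74`), all of which are discharged elsewhere in the
tree; the unconditional theorem `exists_oracle_BQPRel_not_subset_BPPRel_holds` is assembled in
`OracleSeparationsProofs.lean`.

## The argument

The proof is *not* Bernstein–Vazirani's (whose separating problem, recursive Fourier sampling, and
whose machine model, oracle QTMs, are not in the tree); it is Raz–Tal's Appendix A — which the tree
proves in full for `PH^A` (`exists_oracle_BQPRel_not_subset_PHRel_of`) — run against bounded-error
probabilistic oracle machines instead of `PH^A` predicates. (Semantically `BPP^A ⊆ PH^A` for every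
`A` by the relativized Sipser–Gács–Lautemann theorem, so Raz–Tal's oracle itself separates `BQP`
from `BPP`; that inclusion is not in the tree, and the direct diagonalization below avoids it.)

A `BPP^A` language (`BPPRel (Oracle.ofLanguage A) = bp (PRel _)`) is given by a polynomial-time
oracle algorithm `M` with round/query bound `q` deciding `L' ∈ P^A` on pairs `⟨x, r⟩`, and a coin
polynomial `p`: `x ∈ L` iff at least `2/3` of the coin strings `r ∈ {0,1}^{p(|x|)}` have
`⟨x, r⟩ ∈ L'`, and at most `1/3` of them otherwise. Its *acceptance probability*
`Pr_r[⟨x, r⟩ ∈ L'(A)]`, `L'(A) = baseLang M q A`, is written out as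
`uniformProb (p(|x|)) {r | boolPair x r ∈ baseLang M q A}` throughout (no new definition is
introduced; the file only proves theorems).

* **Locality** (`uniformProb_baseLang_congr`): the acceptance probability at `x` reads the oracle
  only below the reach of the description `⟨[p], M, q⟩` (Baker–Gill–Solovay 1975, §1), so the
  stage machinery `diagSeq`/`diagW` of the `PH` file, which freezes exactly that much, is reused
  verbatim with the enumeration `exists_enum_PHDescr` (a triple `(M, q, p)` *is* the description
  `⟨[p], M, q⟩`; conversely a description `D` is read as the triple `(D.M, D.q, D.bounds.headD 0)`).
* **Claim 8.2 for `BPP` tests** (`bpp_gap_small`): the acceptance probability, as a function of the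
  level-`n` window, is the average over `r` of the indicators `phInd ⟨[], M, q⟩ ⟨1ⁿ, r⟩` of a
  *depth-2* window circuit (Ko 1989, Lemma 2.1 — the base case of `FSS84_phWindowCircuits`), each
  of which has `𝒟₁`-versus-uniform gap at most Raz–Tal's bound at probe length `2n + 2 + p(n)`
  (`razTal_claim82`); an average of gaps is at most the largest gap (`abs_avg_gap_le`), and the
  bound still tends to `0` (`rtBound_eventually_le`, the estimate of `razTal_claim82_small` for an
  arbitrary size polynomial).
* **Stage lemma** (`exists_defeating_window_bpp`; Bernstein–Vazirani 1997, proof of Cor. 8.14: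
  "`M^O` … has success probability less than `2/3` on input `0ⁿ`"): at every large level and for
  every background oracle some window `w` and verdict `β` have `Q₁` on the side of `β`
  (`q1Accept ≥ 2/3`, resp. `≤ 1/3`) while the acceptance probability of `(M, q, p)` at `1ⁿ` is
  *not* (`< 2/3`, resp. `> 1/3`). Otherwise the acceptance probability `f ∈ [0,1]` satisfies
  `2·acc − 4/3 ≤ f ≤ 2·acc + 1/3` pointwise, whence `𝔼_{𝒟₁} f − 𝔼_U f ≥ 1/3 − 4/n² > 1/10` by
  Claim 8.1, contradicting Claim 8.2.
* **Assembly** (`exists_oracle_BQPRel_not_subset_BPPRel_of`): the oracle is the limit `langOf (diagW …)`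
  of the stages, the separating language is `L = {x : |x| ≥ N₀ ∧ q1Accept (x_{|x|}) ≥ 2/3} ∈ BQP^A`
  exactly as in the `PH` file, and if `L ∈ BPP^A` via `(M, q, p)` then the stage that treated the
  description `⟨[p], M, q⟩` at level `n` makes the `2/3`-promise fail at `1ⁿ`
  (`uniformProb_compl` turns the promise at `x ∉ L` into `acc ≤ 1/3`).

## References

* E. Bernstein, U. Vazirani, *Quantum complexity theory*, SIAM J. Comput. 26(5) (1997) 1411–1473,
  §8.4: Thm. 8.10, Lemma 8.12, Thm. 8.13, Cor. 8.14 [BernsteinVazirani1997].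
* R. Raz, A. Tal, *Oracle separation of BQP and PH*, J. ACM 69(4) (2022), Art. 30, App. A,
  Claims 8.1–8.2, Cor. 1.5 [RazTalJACM2022].
* K.-I Ko, *Constructing oracles by lower bound techniques for circuits* (1989), Lemma 2.1, §3 [Ko1989].
* T. Baker, J. Gill, R. Solovay, SIAM J. Comput. 4 (1975), §1 [BakerGillSolovay1975].
* S. Arora, B. Barak, *Computational Complexity* (2009), Def. 7.3, §7.1 [AroraBarak2009].
-/

namespace Literature.Computability.QuantumComplexity

open _root_.Computability Complexity Cryptography Finset

/-! ### Two elementary averaging facts -/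

/-- **An average of small gaps is a small gap.** If every test `φ r` (`r ∈ R`) has
`|∑_x μ(x) φ_r(x) − (∑_x φ_r(x))/|X|| ≤ B`, then so does the average test `x ↦ (∑_r φ_r(x))/|R|`
(linearity of both expectations and the triangle inequality). [folklore] -/
theorem abs_avg_gap_le {X R : Type*} [Fintype X] [Fintype R] (μ : X → ℝ) (φ : R → X → ℝ)
    {N B : ℝ} (hN : (Fintype.card R : ℝ) = N) (hN0 : 0 < N)
    (h : ∀ r, |∑ x, μ x * φ r x - (∑ x, φ r x) / Fintype.card X| ≤ B) :
    |∑ x, μ x * ((∑ r, φ r x) / N) - (∑ x, (∑ r, φ r x) / N) / Fintype.card X| ≤ B := by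
  have h1 : ∑ x, μ x * ((∑ r, φ r x) / N) = (∑ r, ∑ x, μ x * φ r x) / N := by
    rw [Finset.sum_comm, Finset.sum_div]
    refine Finset.sum_congr rfl fun x _ => ?_
    rw [← mul_div_assoc, Finset.mul_sum]
  have h2 : (∑ x, (∑ r, φ r x) / N) / Fintype.card X = (∑ r, (∑ x, φ r x) / Fintype.card X) / N := by
    rw [← Finset.sum_div, ← Finset.sum_div, Finset.sum_comm, div_right_comm]
  rw [h1, h2, ← sub_div, ← Finset.sum_sub_distrib, abs_div, abs_of_pos hN0, div_le_iff₀ hN0]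
  calc |∑ r, (∑ x, μ x * φ r x - (∑ x, φ r x) / Fintype.card X)|
      ≤ ∑ r, |∑ x, μ x * φ r x - (∑ x, φ r x) / Fintype.card X| := Finset.abs_sum_le_sum_abs _ _
    _ ≤ ∑ _r : R, B := Finset.sum_le_sum fun r _ => h r
    _ = B * N := by rw [Finset.sum_const, Finset.card_univ, nsmul_eq_mul, hN, mul_comm]

/-- **The Claim 8.2 bound tends to `0` for every size polynomial**: for `c > 0`, an exponent `k`
and a polynomial `S`, `m(n) · 16 ε (c log 2^{S(n)+1})^k / √N ≤ t` for all large `n` (the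
estimate `polylog(N)/√N → 0` of Raz–Tal App. A, as in `razTal_claim82_small`, for an arbitrary
`S` and `k`). [cite: RazTalJACM2022, App. A] -/
theorem rtBound_eventually_le {c : ℝ} (hc : 0 < c) (k : ℕ) (S : Polynomial ℕ) {t : ℝ}
    (ht : 0 < t) :
    ∃ n₁ : ℕ, ∀ n, n₁ ≤ n →
      rtBlocks n * (16 * razTalEps (2 ^ n) *
        (c * Real.log (2 ^ (S.eval n + 1) : ℕ)) ^ k / Real.sqrt (2 ^ n : ℕ)) ≤ t := by
  obtain ⟨K, Dg, hK, hS⟩ := exists_monomial_bound S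
  set b : ℕ → ℝ := fun n => rtBlocks n * (16 * razTalEps (2 ^ n) *
    (c * Real.log (2 ^ (S.eval n + 1) : ℕ)) ^ k / Real.sqrt (2 ^ n : ℕ)) with hb
  have hdom : ∀ n, 1 ≤ n →
      b n ≤ (18496 * 16 * (c * K) ^ k) * (n : ℝ) ^ (3 + Dg * k) / Real.sqrt 2 ^ n := by
    intro n hn
    have heps : razTalEps (2 ^ n) ≤ 1 := (razTalEps_le_half hn).trans (by norm_num)
    have hlog : Real.log (2 ^ (S.eval n + 1) : ℕ) ≤ K * (n : ℝ) ^ Dg := by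
      have h1 : Real.log (2 ^ (S.eval n + 1) : ℕ) = (S.eval n + 1 : ℕ) * Real.log 2 := by
        rw [Nat.cast_pow, Real.log_pow]; norm_num
      rw [h1]
      have h2 : Real.log 2 ≤ 1 := by
        have := Real.log_two_lt_d9; linarith
      have h3 : ((S.eval n + 1 : ℕ) : ℝ) ≤ K * (n : ℝ) ^ Dg := by push_cast; exact hS n hn
      calc ((S.eval n + 1 : ℕ) : ℝ) * Real.log 2 ≤ (K * (n : ℝ) ^ Dg) * 1 :=
            mul_le_mul h3 h2 (Real.log_nonneg (by norm_num)) (by positivity)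
        _ = K * (n : ℝ) ^ Dg := mul_one _
    have hlog0 : 0 ≤ Real.log (2 ^ (S.eval n + 1) : ℕ) := Real.log_natCast_nonneg _
    have hpow : (c * Real.log (2 ^ (S.eval n + 1) : ℕ)) ^ k ≤ (c * K) ^ k * (n : ℝ) ^ (Dg * k) := by
      rw [pow_mul (n : ℝ) Dg k, ← mul_pow]
      refine pow_le_pow_left₀ (mul_nonneg hc.le hlog0) ?_ k
      rw [mul_assoc]
      exact mul_le_mul_of_nonneg_left hlog hc.le
    have hP0 : 0 ≤ (c * Real.log (2 ^ (S.eval n + 1) : ℕ)) ^ k :=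
      pow_nonneg (mul_nonneg hc.le hlog0) k
    have hnum : 16 * razTalEps (2 ^ n) * (c * Real.log (2 ^ (S.eval n + 1) : ℕ)) ^ k ≤
        16 * ((c * K) ^ k * (n : ℝ) ^ (Dg * k)) := by
      calc 16 * razTalEps (2 ^ n) * (c * Real.log (2 ^ (S.eval n + 1) : ℕ)) ^ k
          ≤ 16 * 1 * (c * Real.log (2 ^ (S.eval n + 1) : ℕ)) ^ k :=
            mul_le_mul_of_nonneg_right (mul_le_mul_of_nonneg_left heps (by norm_num)) hP0
        _ ≤ 16 * 1 * ((c * K) ^ k * (n : ℝ) ^ (Dg * k)) :=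
            mul_le_mul_of_nonneg_left hpow (by norm_num)
        _ = _ := by ring
    have hm : (rtBlocks n : ℝ) = 18496 * (n : ℝ) ^ 3 := by simp [rtBlocks]
    have hsq : 0 < Real.sqrt 2 ^ n := by positivity
    calc b n = 18496 * (n : ℝ) ^ 3 * (16 * razTalEps (2 ^ n) *
          (c * Real.log (2 ^ (S.eval n + 1) : ℕ)) ^ k / Real.sqrt 2 ^ n) := by
            simp only [hb, hm, sqrt_two_pow_natCast]
      _ ≤ 18496 * (n : ℝ) ^ 3 * (16 * ((c * K) ^ k * (n : ℝ) ^ (Dg * k)) / Real.sqrt 2 ^ n) :=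
            mul_le_mul_of_nonneg_left (div_le_div_of_nonneg_right hnum hsq.le) (by positivity)
      _ = (18496 * 16 * (c * K) ^ k) * (n : ℝ) ^ (3 + Dg * k) / Real.sqrt 2 ^ n := by
            rw [pow_add]; ring
  exact eventually_le_of_poly_div_exp hdom ht

/-! ### Acceptance probabilities of `P^A` machines with coins, as window statistics -/

/-- **The acceptance probability of a `BPP^A` description is an average of depth-2 window tests.**
For the `P^A` machine `M` with bound `q` and coin length `p(|z|)`, the probability over the coins
`r` that `⟨z, r⟩` is accepted, against the background oracle `A₀` patched by the level-`n` window
`x`, is the average over `r` of the indicators `phInd ⟨[], M, q⟩ ⟨z, r⟩` (Arora–Barak 2009,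
Def. 7.3: `BPP` via random strings; Ko 1989, Lemma 2.1: the innermost predicate).
[cite: AroraBarak2009, Def. 7.3] -/
theorem uniformProb_baseLang_eq_sum (M : OracleAlg Bool) (q p : Polynomial ℕ) (A₀ : Language Bool)
    (n : ℕ) (x : Window n) (z : List Bool) :
    uniformProb (p.eval z.length) {r | boolPair z r ∈ baseLang M q (patchLevel A₀ n x)} =
      (∑ r : List.Vector Bool (p.eval z.length),
          phInd ⟨[], M, q⟩ (boolPair z r.toList) A₀ n x) / 2 ^ (p.eval z.length) := by
  classical
  rw [uniformProb_eq_cnt_div, cnt]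
  congr 1
  have hφ : ∀ r : List.Vector Bool (p.eval z.length),
      phInd ⟨[], M, q⟩ (boolPair z r.toList) A₀ n x =
        if r.toList ∈ {r | boolPair z r ∈ baseLang M q (patchLevel A₀ n x)} then 1 else 0 := by
    intro r
    simp only [phInd, PHDescr.lang, levelLang_nil, Set.mem_setOf_eq]
    by_cases hr : boolPair z r.toList ∈ baseLang M q (patchLevel A₀ n x)
    · rw [if_pos ((Set.mem_iff_boolIndicator _ _).1 hr), if_pos hr]
    · rw [if_neg hr, if_neg]
      rw [(Set.notMem_iff_boolIndicator _ _).1 hr]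
      exact Bool.false_ne_true
  simp_rw [hφ]
  rw [Finset.sum_boole]
  congr

/-- **Locality of the acceptance probability** (Baker–Gill–Solovay 1975, §1: an oracle machine
reads only the strings it queries): if two oracle languages agree on all strings of length at most
the reach of the description `⟨[p], M, q⟩` at `|z|` — the largest query bound `q(2|z| + 2 + j)` over
the coin lengths `j ≤ p(|z|)` — then the probabilities over `r ∈ {0,1}^{p(|z|)}` that `⟨z, r⟩` is
accepted agree. [cite: BakerGillSolovay1975, §1] -/
theorem uniformProb_baseLang_congr (M : OracleAlg Bool) (q p : Polynomial ℕ) {A A' : Language Bool}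
    (z : List Bool)
    (h : ∀ s : List Bool, s.length ≤ PHDescr.reach ⟨[p], M, q⟩ z.length → (s ∈ A ↔ s ∈ A')) :
    uniformProb (p.eval z.length) {r | boolPair z r ∈ baseLang M q A} =
      uniformProb (p.eval z.length) {r | boolPair z r ∈ baseLang M q A'} := by
  rw [uniformProb_eq_cnt_div, uniformProb_eq_cnt_div, cnt_congr]
  intro r hr
  simp only [Set.mem_setOf_eq]
  refine levelLang_congr M q [] (boolPair z r) fun s hs => h s (hs.trans ?_)
  change levelReach q [] (boolPair z r).length ≤
    (Finset.range (p.eval z.length + 1)).sup fun j => levelReach q [] (2 * z.length + 2 + j)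
  rw [length_boolPair, hr]
  exact Finset.le_sup (f := fun j => levelReach q [] (2 * z.length + 2 + j))
    (Finset.mem_range.2 (Nat.lt_succ_self _))

/-! ### Claim 8.2 for `BPP^A` descriptions -/

/-- **Raz–Tal, Claim 8.2, for bounded-error probabilistic oracle machines**: for every `P^A`
machine `M` with bound `q` and coin polynomial `p`, from some level `n` on, for every background
oracle, writing `𝒟₁` or the uniform window into level `n` changes the acceptance probability at
the probe `1ⁿ` by at most `1/10` (each coin string gives a depth-2 circuit of size `2^{poly(n)}` in
the window bits, Ko 1989, Lemma 2.1, to which `razTal_claim82` applies at probe length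
`2n + 2 + p(n)`; average over the coins). [cite: RazTalJACM2022, Claim 8.2] [cite: Ko1989, Lemma 2.1] -/
theorem bpp_gap_small (h3 : FSS84_phWindowCircuits) (h74 : RazTal2022_thm74) (M : OracleAlg Bool)
    (q p : Polynomial ℕ) :
    ∃ n₀ : ℕ, ∀ n, n₀ ≤ n → ∀ A₀ : Language Bool,
      |∑ x : Window n, rtD1 n x *
            uniformProb (p.eval n)
              {r | boolPair (List.replicate n true) r ∈ baseLang M q (patchLevel A₀ n x)} -
          (∑ x : Window n, uniformProb (p.eval n)
              {r | boolPair (List.replicate n true) r ∈ baseLang M q (patchLevel A₀ n x)}) /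
            Fintype.card (Window n)| ≤ 1 / 10 := by
  obtain ⟨c, n₀, S, hc, h⟩ := razTal_claim82 h3 h74 ⟨[], M, q⟩
  -- the size polynomial at probe length `2n + 2 + p(n)`
  set S' : Polynomial ℕ := S.comp (Polynomial.C 2 * Polynomial.X + Polynomial.C 2 + p) with hS'
  have hS'eval : ∀ n : ℕ, S'.eval n = S.eval (2 * n + 2 + p.eval n) := fun n => by
    simp [hS', Polynomial.eval_comp]
  obtain ⟨n₁, hn₁⟩ := rtBound_eventually_le hc 2 S' (t := 1 / 10) (by norm_num)
  refine ⟨max n₀ n₁, fun n hn A₀ => ?_⟩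
  have hn₀ : n₀ ≤ n := (le_max_left _ _).trans hn
  have key : ∀ x : Window n,
      uniformProb (p.eval n) {r | boolPair (List.replicate n true) r ∈ baseLang M q (patchLevel A₀ n x)} =
        (∑ r : List.Vector Bool (p.eval n),
            phInd ⟨[], M, q⟩ (boolPair (List.replicate n true) r.toList) A₀ n x) / 2 ^ (p.eval n) := by
    intro x
    have := uniformProb_baseLang_eq_sum M q p A₀ n x (List.replicate n true)
    rwa [List.length_replicate] at this
  simp_rw [key]
  have hB : ∀ r : List.Vector Bool (p.eval n),
      |∑ x : Window n, rtD1 n x * phInd ⟨[], M, q⟩ (boolPair (List.replicate n true) r.toList) A₀ n x -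
          (∑ x : Window n, phInd ⟨[], M, q⟩ (boolPair (List.replicate n true) r.toList) A₀ n x) /
            Fintype.card (Window n)| ≤
        rtBlocks n * (16 * razTalEps (2 ^ n) *
          (c * Real.log (2 ^ (S'.eval n + 1) : ℕ)) ^ 2 / Real.sqrt (2 ^ n : ℕ)) := by
    intro r
    have h' := h n hn₀ (boolPair (List.replicate n true) r.toList) A₀
    rw [length_boolPair, List.length_replicate, List.Vector.toList_length] at h'
    rw [hS'eval n]
    simpa using h'
  have hcard : (Fintype.card (List.Vector Bool (p.eval n)) : ℝ) = 2 ^ (p.eval n) := by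
    rw [card_vector, Fintype.card_bool]; push_cast; rfl
  exact (abs_avg_gap_le (rtD1 n)
    (fun (r : List.Vector Bool (p.eval n)) (x : Window n) =>
      phInd ⟨[], M, q⟩ (boolPair (List.replicate n true) r.toList) A₀ n x)
    hcard (by positivity) hB).trans (hn₁ n ((le_max_right _ _).trans hn))

/-! ### Stage lemma: at a large level, some window defeats a given `BPP^A` description -/

/-- **The stage lemma of the diagonalization against `BPP^A`** (Bernstein–Vazirani 1997, proof of
Cor. 8.14: for each probabilistic machine and all large `n`, some oracle makes it err or lose its
`2/3` advantage at `0ⁿ`; here in Raz–Tal's setting, App. A with Claims 8.1–8.2). For every `P^A`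
machine `M` with bound `q` and coin polynomial `p`, at every large level `n` and for every
background oracle there are a window `w` and a verdict `β` such that `Q₁` is on the side of `β`
(`q1Accept n w ≥ 2/3` if `β`, `≤ 1/3` if not) while the acceptance probability of `(M, q, p)` at
`1ⁿ` is not (`< 2/3`, resp. `> 1/3`). Proof: otherwise that probability `f` satisfies
`2·acc − 4/3 ≤ f ≤ 2·acc + 1/3`, so `𝔼_{𝒟₁} f − 𝔼_U f ≥ 1/3 − 4/n² > 1/10` by Claim 8.1,
contradicting `bpp_gap_small`. [cite: BernsteinVazirani1997, Cor. 8.14] [cite: RazTalJACM2022, App. A] -/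
theorem exists_defeating_window_bpp (h2 : RazTal2022_claim81) (h3 : FSS84_phWindowCircuits)
    (h74 : RazTal2022_thm74) (M : OracleAlg Bool) (q p : Polynomial ℕ) :
    ∃ n₀ : ℕ, ∀ n, n₀ ≤ n → ∀ A₀ : Language Bool, ∃ (w : Window n) (β : Bool),
      (β = true → 2 / 3 ≤ q1Accept n w ∧
        uniformProb (p.eval n)
          {r | boolPair (List.replicate n true) r ∈ baseLang M q (patchLevel A₀ n w)} < 2 / 3) ∧
      (β = false → q1Accept n w ≤ 1 / 3 ∧
        1 / 3 < uniformProb (p.eval n)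
          {r | boolPair (List.replicate n true) r ∈ baseLang M q (patchLevel A₀ n w)}) := by
  obtain ⟨n₁, h81⟩ := h2
  obtain ⟨n₂, h82⟩ := bpp_gap_small h3 h74 M q p
  refine ⟨max (max n₁ n₂) 5, fun n hn A₀ => ?_⟩
  have hn₁ : n₁ ≤ n := le_trans (le_trans (le_max_left _ _) (le_max_left _ _)) hn
  have hn₂ : n₂ ≤ n := le_trans (le_trans (le_max_right _ _) (le_max_left _ _)) hn
  have hn5 : (5 : ℝ) ≤ n := by exact_mod_cast (le_max_right _ _).trans hn
  -- the acceptance probability as a function of the window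
  set f : Window n → ℝ := fun x => uniformProb (p.eval n)
    {r | boolPair (List.replicate n true) r ∈ baseLang M q (patchLevel A₀ n x)} with hf
  have hf0 : ∀ x, 0 ≤ f x := fun x => uniformProb_nonneg _ _
  have hf1 : ∀ x, f x ≤ 1 := fun x => uniformProb_le_one _ _
  by_contra H
  -- pointwise sandwich of `f` by the acceptance probability of `Q₁`
  have hlow : ∀ x : Window n, 2 * q1Accept n x - 4 / 3 ≤ f x := by
    intro x
    by_cases hx : 2 / 3 ≤ q1Accept n x
    · have h23 : 2 / 3 ≤ f x :=
        not_lt.1 fun hlt => H ⟨x, true, fun _ => ⟨hx, hlt⟩, fun h => Bool.noConfusion h⟩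
      linarith [q1Accept_le_one n x]
    · linarith [hf0 x]
  have hup : ∀ x : Window n, f x ≤ 2 * q1Accept n x + 1 / 3 := by
    intro x
    by_cases hx : q1Accept n x ≤ 1 / 3
    · have h13 : f x ≤ 1 / 3 :=
        not_lt.1 fun hlt => H ⟨x, false, fun h => Bool.noConfusion h, fun _ => ⟨hx, hlt⟩⟩
      linarith [q1Accept_nonneg n x]
    · linarith [hf1 x]
  obtain ⟨hD, hU⟩ := h81 n hn₁
  have hcard : (0 : ℝ) < Fintype.card (Window n) := by exact_mod_cast Fintype.card_pos
  -- expectation under `𝒟₁`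
  have hED : 2 / 3 - 2 / (n : ℝ) ^ 2 ≤ ∑ x, rtD1 n x * f x := by
    have h1 : ∑ x, rtD1 n x * (2 * q1Accept n x - 4 / 3) ≤ ∑ x, rtD1 n x * f x :=
      Finset.sum_le_sum fun x _ => mul_le_mul_of_nonneg_left (hlow x) (rtD1_nonneg n x)
    have h2 : ∑ x, rtD1 n x * (2 * q1Accept n x - 4 / 3) =
        2 * ∑ x, rtD1 n x * q1Accept n x - 4 / 3 := by
      have h3 : ∀ x, rtD1 n x * (2 * q1Accept n x - 4 / 3) =
          2 * (rtD1 n x * q1Accept n x) - 4 / 3 * rtD1 n x := fun x => by ring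
      simp_rw [h3]
      rw [Finset.sum_sub_distrib, ← Finset.mul_sum, ← Finset.mul_sum, sum_rtD1, mul_one]
    have h4 : 2 * (1 - 1 / (n : ℝ) ^ 2) - 4 / 3 = 2 / 3 - 2 / (n : ℝ) ^ 2 := by ring
    linarith
  -- expectation under the uniform distribution
  have hEU : (∑ x, f x) / Fintype.card (Window n) ≤ 2 / (n : ℝ) ^ 2 + 1 / 3 := by
    have h1 : ∑ x, f x ≤ 2 * ∑ x, q1Accept n x + Fintype.card (Window n) * (1 / 3) := by
      calc ∑ x, f x ≤ ∑ x, (2 * q1Accept n x + 1 / 3) := Finset.sum_le_sum fun x _ => hup x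
        _ = 2 * ∑ x, q1Accept n x + Fintype.card (Window n) * (1 / 3) := by
          rw [Finset.sum_add_distrib, ← Finset.mul_sum, Finset.sum_const, Finset.card_univ,
            nsmul_eq_mul]
    have h2 : (∑ x, f x) / Fintype.card (Window n) ≤
        2 * ((∑ x, q1Accept n x) / Fintype.card (Window n)) + 1 / 3 := by
      rw [div_le_iff₀ hcard]
      calc ∑ x, f x ≤ 2 * ∑ x, q1Accept n x + Fintype.card (Window n) * (1 / 3) := h1
        _ = (2 * ((∑ x, q1Accept n x) / Fintype.card (Window n)) + 1 / 3) *
              Fintype.card (Window n) := by field_simp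
    have h4 : (2 : ℝ) / (n : ℝ) ^ 2 = 2 * (1 / (n : ℝ) ^ 2) := by ring
    rw [h4]
    linarith [mul_le_mul_of_nonneg_left hU (show (0 : ℝ) ≤ 2 by norm_num)]
  have h4n : 4 / (n : ℝ) ^ 2 ≤ 4 / 25 := by
    rw [div_le_div_iff₀ (by positivity) (by norm_num)]; nlinarith
  have hgap := h82 n hn₂ A₀
  have := le_abs_self (∑ x, rtD1 n x * f x - (∑ x, f x) / Fintype.card (Window n))
  have h2n : (2 : ℝ) / (n : ℝ) ^ 2 + 2 / (n : ℝ) ^ 2 = 4 / (n : ℝ) ^ 2 := by ring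
  linarith

/-! ### Assembly: `BQP^A ⊄ BPP^A` from the named facts -/

/-- **Bernstein–Vazirani 1997, §8.4 (Thm. 8.10 with Cor. 8.14): `∃ A, BQP^A ⊄ BPP^A`, from the
named facts of Raz–Tal's Appendix A** (in the deterministic stage-wise form of Ko 1989, §3, exactly
as `exists_oracle_BQPRel_not_subset_PHRel_of`). Given the uniform `BQP^O` machine running `Q₁` on
the level-`n` window (`RazTal2022_bqpMachine`), Claim 8.1 (`RazTal2022_claim81`), the window-circuit
conversion (`FSS84_phWindowCircuits`, of which only the depth-2 base case, Ko's Lemma 2.1, is used),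
countability of polynomial-time oracle machines (`countable_polyTimeOracleAlg`) and Theorem 7.4
(`RazTal2022_thm74`), there is an oracle `A` with `BQP^A ⊄ BPP^A`: the oracle is the limit of the
stages `diagSeq` run with the `BPP` stage lemma `exists_defeating_window_bpp` (a description `D` of
the enumeration being read as the machine `(D.M, D.q)` with coin polynomial `D.bounds.headD 0`),
the separating language is `L = {x : |x| ≥ N₀, q1Accept |x| (x_{|x|}) ≥ 2/3} ∈ BQP^A`, and a
`BPP^A` machine `(M, q, p)` for `L` is defeated at the level of the stage treating `⟨[p], M, q⟩`,
where its acceptance probability at `1ⁿ` is on the wrong side of the `2/3`-promise.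
[cite: BernsteinVazirani1997, §8.4 Thm. 8.10 and Cor. 8.14] [cite: RazTalJACM2022, Cor. 1.5 (App. A)] [cite: Ko1989, §3] -/
theorem exists_oracle_BQPRel_not_subset_BPPRel_of (h1 : RazTal2022_bqpMachine)
    (h2 : RazTal2022_claim81) (h3 : FSS84_phWindowCircuits) (h5 : countable_polyTimeOracleAlg)
    (h74 : RazTal2022_thm74) : exists_oracle_BQPRel_not_subset_BPPRel := by
  classical
  -- enumeration of the descriptions and the choices of the `BPP` stage lemma
  obtain ⟨e, he⟩ := exists_enum_PHDescr h5
  choose thr hthr using fun D : PHDescr =>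
    exists_defeating_window_bpp h2 h3 h74 D.M D.q (D.bounds.headD 0)
  have hthr' : ∀ (D : PHDescr) (n : ℕ) (A₀ : Language Bool), ∃ pr : Window n × Bool, thr D ≤ n →
      (pr.2 = true → 2 / 3 ≤ q1Accept n pr.1 ∧
        uniformProb ((D.bounds.headD 0).eval n)
          {r | boolPair (List.replicate n true) r ∈ baseLang D.M D.q (patchLevel A₀ n pr.1)} <
            2 / 3) ∧
      (pr.2 = false → q1Accept n pr.1 ≤ 1 / 3 ∧
        1 / 3 < uniformProb ((D.bounds.headD 0).eval n)
          {r | boolPair (List.replicate n true) r ∈ baseLang D.M D.q (patchLevel A₀ n pr.1)}) := by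
    intro D n A₀
    by_cases hn : thr D ≤ n
    · obtain ⟨w, β, h⟩ := hthr D n hn A₀
      exact ⟨(w, β), fun _ => h⟩
    · exact ⟨(fun _ _ => false, false), fun h => absurd h hn⟩
  choose pick hpick using hthr'
  -- default windows and the first level
  obtain ⟨n₁, h81⟩ := h2
  choose W₀ hW₀ using exists_good_window h81
  set N₀ : ℕ := max n₁ 2 with hN₀
  -- the oracle
  set W : ∀ n, Window n := diagW W₀ N₀ thr pick e with hW
  refine ⟨langOf W, fun hsub => ?_⟩
  -- every window of the oracle respects the promise of `Q₁`
  have hprom : ∀ n, N₀ ≤ n → 2 / 3 ≤ q1Accept n (W n) ∨ q1Accept n (W n) ≤ 1 / 3 := by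
    intro n hn
    rcases diagW_eq_or W₀ N₀ thr pick e n with h | ⟨i, rfl⟩
    · left; rw [hW, h]; exact hW₀ n hn
    · have hp := hpick (e i) (stageLvl W₀ N₀ thr pick e i)
        (langOf (diagSeq W₀ N₀ thr pick e i).W) (thr_le_stageLvl W₀ N₀ thr pick e i)
      rw [hW, diagW_stageLvl]
      obtain ⟨ht, hf⟩ := hp
      cases hβ : (stagePick W₀ N₀ thr pick e i).2
      · exact Or.inr (hf hβ).1
      · exact Or.inl (ht hβ).1
  -- the `BQP^A` machine and the separating language
  obtain ⟨F, hFu, hF⟩ := h1 N₀ fun _ => false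
  set L : Language Bool := {x | N₀ ≤ x.length ∧ 2 / 3 ≤ q1Accept x.length (W x.length)} with hL
  have hLBQP : L ∈ BQPRel (langOf W) := by
    refine ⟨F, hFu, fun x => ⟨fun hx => ?_, fun hx => ?_⟩⟩
    · obtain ⟨hxn, hxq⟩ := hx
      rw [(hF (langOf W) x).2 hxn, rtWindow_langOf]
      exact hxq
    · by_cases hxn : N₀ ≤ x.length
      · rw [(hF (langOf W) x).2 hxn, rtWindow_langOf]
        have hxq : ¬ 2 / 3 ≤ q1Accept x.length (W x.length) := fun h => hx ⟨hxn, h⟩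
        rcases hprom x.length hxn with h | h
        · exact absurd h hxq
        · exact h
      · rw [(hF (langOf W) x).1 (lt_of_not_ge hxn)]
        norm_num
  -- a `BPP^A` machine for `L`: a `P^A` machine `M` with bound `q` on pairs, and coins `p`
  obtain ⟨L', hL'P, p, hp⟩ := hsub hLBQP
  obtain ⟨M, hM, q, hq⟩ := hL'P
  have hbase : baseLang M q (langOf W) = L' := baseLang_eq_of_PRel hq
  -- its description `⟨[p], M, q⟩` is some `e i`; stage `i` defeated it
  obtain ⟨i, hi⟩ := he (show (⟨[p], M, q⟩ : PHDescr) ∈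
    {D : PHDescr | D.M.IsPolyTime encodingBoolBool} from hM)
  have hpk := hpick (e i) (stageLvl W₀ N₀ thr pick e i) (langOf (diagSeq W₀ N₀ thr pick e i).W)
    (thr_le_stageLvl W₀ N₀ thr pick e i)
  have heM : (e i).M = M := by rw [hi]
  have heq : (e i).q = q := by rw [hi]
  have hep : (e i).bounds.headD 0 = p := by rw [hi]; rfl
  simp only [heM, heq, hep] at hpk
  obtain ⟨ht, hf⟩ := hpk
  have hWn : W (stageLvl W₀ N₀ thr pick e i) = (stagePick W₀ N₀ thr pick e i).1 := by
    rw [hW]; exact diagW_stageLvl W₀ N₀ thr pick e i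
  have hN₀n : N₀ ≤ stageLvl W₀ N₀ thr pick e i :=
    le_trans (le_trans (Nat.le_add_right N₀ i) (add_le_lvl W₀ N₀ thr pick e i))
      (lvl_le_stageLvl W₀ N₀ thr pick e i)
  -- the acceptance probability at `1ⁿ` is the same for the stage-`i+1` oracle and for the limit
  have hpatch : patchLevel (langOf (diagSeq W₀ N₀ thr pick e i).W) (stageLvl W₀ N₀ thr pick e i)
      (stagePick W₀ N₀ thr pick e i).1 = langOf (diagSeq W₀ N₀ thr pick e (i + 1)).W := by
    rw [patchLevel_langOf, diagSeq_succ_W]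
  have hloc : uniformProb (p.eval (stageLvl W₀ N₀ thr pick e i))
      {r | boolPair (List.replicate (stageLvl W₀ N₀ thr pick e i) true) r ∈ baseLang M q (langOf W)} =
      uniformProb (p.eval (stageLvl W₀ N₀ thr pick e i))
        {r | boolPair (List.replicate (stageLvl W₀ N₀ thr pick e i) true) r ∈
          baseLang M q (langOf (diagSeq W₀ N₀ thr pick e (i + 1)).W)} := by
    have h := uniformProb_baseLang_congr M q p (A := langOf W)
      (A' := langOf (diagSeq W₀ N₀ thr pick e (i + 1)).W)
      (List.replicate (stageLvl W₀ N₀ thr pick e i) true) (fun s hs => by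
        rw [List.length_replicate] at hs
        rw [hW]
        refine mem_lang_diagW_iff W₀ N₀ thr pick e i s ?_
        rw [hi]; exact hs)
    rwa [List.length_replicate] at h
  -- membership of `1ⁿ` in `L` versus the promise of the `BPP^A` machine
  have hmemL : List.replicate (stageLvl W₀ N₀ thr pick e i) true ∈ L ↔
      2 / 3 ≤ q1Accept (stageLvl W₀ N₀ thr pick e i) (W (stageLvl W₀ N₀ thr pick e i)) := by
    have hlen : (List.replicate (stageLvl W₀ N₀ thr pick e i) true).length =
        stageLvl W₀ N₀ thr pick e i := by simp
    change (N₀ ≤ (List.replicate (stageLvl W₀ N₀ thr pick e i) true).length ∧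
      2 / 3 ≤ q1Accept (List.replicate (stageLvl W₀ N₀ thr pick e i) true).length
        (W (List.replicate (stageLvl W₀ N₀ thr pick e i) true).length)) ↔ _
    rw [hlen]
    exact ⟨fun h => h.2, fun h => ⟨hN₀n, h⟩⟩
  have hprob := hp (List.replicate (stageLvl W₀ N₀ thr pick e i) true)
  rw [List.length_replicate] at hprob
  cases hβ : (stagePick W₀ N₀ thr pick e i).2
  · -- verdict `false`: `Q₁` rejects, so `1ⁿ ∉ L` and the machine accepts with probability `≤ 1/3`
    obtain ⟨hq1, hacc⟩ := hf hβ
    have hnot : List.replicate (stageLvl W₀ N₀ thr pick e i) true ∉ L := fun h => by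
      have h' := hmemL.1 h
      rw [hWn] at h'
      change q1Accept _ (stagePick W₀ N₀ thr pick e i).1 ≤ 1 / 3 at hq1
      linarith
    have hset : {y : List Bool | boolPair (List.replicate (stageLvl W₀ N₀ thr pick e i) true) y ∈ L' ↔
        List.replicate (stageLvl W₀ N₀ thr pick e i) true ∈ L} =
        {y : List Bool | boolPair (List.replicate (stageLvl W₀ N₀ thr pick e i) true) y ∈
          baseLang M q (langOf W)}ᶜ := by
      ext y
      simp only [Set.mem_setOf_eq, Set.mem_compl_iff, hbase, iff_false_right hnot]
    rw [hset, uniformProb_compl, hloc, ← hpatch] at hprob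
    change 1 / 3 < uniformProb _ {r | boolPair _ r ∈ baseLang M q
      (patchLevel (langOf (diagSeq W₀ N₀ thr pick e i).W) (stageLvl W₀ N₀ thr pick e i)
        (stagePick W₀ N₀ thr pick e i).1)} at hacc
    linarith
  · -- verdict `true`: `Q₁` accepts, so `1ⁿ ∈ L` and the machine accepts with probability `≥ 2/3`
    obtain ⟨hq1, hacc⟩ := ht hβ
    have hmem : List.replicate (stageLvl W₀ N₀ thr pick e i) true ∈ L := by
      refine hmemL.2 ?_
      rw [hWn]
      exact hq1
    have hset : {y : List Bool | boolPair (List.replicate (stageLvl W₀ N₀ thr pick e i) true) y ∈ L' ↔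
        List.replicate (stageLvl W₀ N₀ thr pick e i) true ∈ L} =
        {y : List Bool | boolPair (List.replicate (stageLvl W₀ N₀ thr pick e i) true) y ∈
          baseLang M q (langOf W)} := by
      ext y
      simp only [Set.mem_setOf_eq, hbase, iff_true_right hmem]
    rw [hset, hloc, ← hpatch] at hprob
    change uniformProb _ {r | boolPair _ r ∈ baseLang M q
      (patchLevel (langOf (diagSeq W₀ N₀ thr pick e i).W) (stageLvl W₀ N₀ thr pick e i)
        (stagePick W₀ N₀ thr pick e i).1)} < 2 / 3 at hacc
    linarith

end Literature.Computability.QuantumComplexity
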